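import Summits.BirchSwinnertonDyer.BirchSwinnertonDyer.Theorems.TeichmullerTwistDescentCarrierKnapp
import Literature.NumberTheory.ModularSymbols.PeriodHomologyGroupPresentationProofs
import HarnessLib

/-!
# Route `TeichmullerTwistDescent`, crux K `TwistedPeriodLatticeSaturation` (stmt-BirchSwinnertonDyer-25368):
# the carrier datum with Knapp's presentation DISCHARGED — K at `(W, p, χ)` from multiplicity one and the carrier functional

Cell `pub/bsd-wall` (D-0145 line route-BirchSwinnertonDyer-TeichmullerTwistDescent, OPEN rev 7), seat `bsd-line-ttd-p1`
(prover 1/2, g24).  THEOREMS ONLY (no definition, no named fact, no `sorry`).  BSD is not proved by this file; K is NOT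
proved by this file; nothing here closes an item.  `--supports stmt-BirchSwinnertonDyer-25368`.

`TeichmullerTwistDescentCarrierKnapp` left Knapp's presentation of `H₁(Γ₀(N), ℤ)` as the explicit hypothesis
`H : periodFunctional_ker_le_ellipticParabolic_sup_commutator`; the tree PROVES it
(`Literature.…PeriodHomologyGroupPresentationProofs.periodFunctional_ker_le_ellipticParabolic_sup_commutator_holds`).  Feeding
that theorem in:

* **`not_caseOne_of_carrier_of_multOne`**: case (1) of the Gauss-sum dichotomy is impossible granted ONLY the residue-field
  presentation of `k`, the carrier functional `Ψ` (equivariance `hΨ`, finite index `hm`, reduction-socle bound `hsoc`) and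
  `MultOneHyp ℤ_p p M hpM f`;
* **`saturation_at_of_carrier_of_multOne`**: the crux conclusion `Λ(f_D) ⊆ g(χ)·Λ(f_D ⊗ χ)` at `(W, p, χ)` (conductor written
  `p²M`, `p ∤ M`, `p ≥ 11`) from modularity `exists_isNewformOf`, the carrier functional and `MultOneHyp`.

REMAINING INPUTS of the K-line after this file (explicit hypotheses, none asserted): `MultOneHyp` (Atkin–Lehner multiplicity
one for the newform `f_D`, operator-free form of `FullLevelHomologySpreadKernel`); the carrier functional `Ψ` with `hΨ`, `hm`,
`hsoc` (the integral tame-type statement (I1)/(I3)/(I4)/(I6) of the line memo); modularity.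
-/

set_option linter.dupNamespace false

noncomputable section

open scoped Pointwise MatrixGroups TensorProduct

open Function CongruenceSubgroup
open Literature.RepresentationTheory.FiniteGroups Literature.RepresentationTheory.FiniteGroups.GL2
  Literature.NumberTheory.EllipticCurves.ModularForms
open Literature.NumberTheory.EllipticCurves (Kato2004.teichmullerChar)
open Literature.NumberTheory.ModularSymbols Literature.NumberTheory.ModularSymbols.FullLevel
open Literature.Algebra.Homology

namespace Summit.BirchSwinnertonDyer.BirchSwinnertonDyer.Theorems.TeichmullerTwistDescent.CarrierMultOne

open WeierstrassCurve Literature.NumberTheory.EllipticCurves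
  Summit.BirchSwinnertonDyer.BirchSwinnertonDyer.Theorems.TeichmullerTwistDescent.CarrierKnapp

variable (p M : ℕ) [hp : Fact p.Prime] [NeZero M] [NeZero (p ^ 2 * M)] (hpM : Nat.Coprime p M)
  [Fintype (diagTorus (ZMod p))] [Invertible (Fintype.card (diagTorus (ZMod p)) : ℤ_[p])]

/-- **Case (1) of the Gauss-sum dichotomy is impossible from the carrier functional and multiplicity one**
(`CarrierKnapp.not_caseOne_of_carrier_of_knapp` with Knapp's presentation supplied by the tree's theorem
`periodFunctional_ker_le_ellipticParabolic_sup_commutator_holds`). -/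
theorem not_caseOne_of_carrier_of_multOne (hp5 : 5 ≤ p) {k : Type} [Field k] [CharP k p] [Algebra ℤ_[p] k] [Finite k]
    (hsurj : Surjective (algebraMap ℤ_[p] k))
    (halg : ∀ x : ℤ_[p], algebraMap ℤ_[p] k x = ZMod.castHom (dvd_refl p) k (PadicInt.toZMod x))
    (f : CuspForm (Gamma0 (p ^ 2 * M)) 2) {b : ℕ} (hb : 0 < b) (hb2 : 2 * b < p - 1)
    {χ : DirichletCharacter ℂ p} (hχ : χ.IsQuadratic) (hprim : χ.IsPrimitive)
    (Ψ : spreadLattice ℤ_[p] p M hpM f →ₗ[ℤ_[p]] (Option (ZMod p) → ℤ_[p]))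
    (hΨ : IsEquivariantOnSpread ℤ_[p] p M hpM f
      (coordRep (Kato2004.teichmullerChar p ^ (p - 1 - b)) (Kato2004.teichmullerChar p ^ b)) Ψ)
    {m : ℕ} (hm : ∀ v : Option (ZMod p) → ℤ_[p], (p : ℤ_[p]) ^ m • v ∈ LinearMap.range Ψ)
    (hsoc : ∀ Λ' : Subrepresentation (coordRep (Kato2004.teichmullerChar p ^ (p - 1 - b)) (Kato2004.teichmullerChar p ^ b)),
      Λ'.toSubmodule = LinearMap.range Ψ →
        ReductionSocleLe p k (Kato2004.teichmullerChar p ^ (p - 1 - b)) (Kato2004.teichmullerChar p ^ b) (2 * b) Λ')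
    (hM1 : MultOneHyp ℤ_[p] p M hpM f)
    (hcase : ∀ w ∈ periodLattice (charTwist (p ^ 2 * M) dvd_rfl (dvd_mul_right (p ^ 2) M) hχ f), ∃ z ∈ periodLattice f,
      gaussSum χ (ZMod.stdAddChar (N := p)) * w = (p : ℂ) * z) : False :=
  not_caseOne_of_carrier_of_knapp p M hpM hp5 hsurj halg f hb hb2 hχ hprim Ψ hΨ hm hsoc
    periodFunctional_ker_le_ellipticParabolic_sup_commutator_holds hM1 hcase

/-- **The crux conclusion at `(W, p, χ)` from modularity, the carrier functional and multiplicity one**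
(`CarrierKnapp.saturation_at_of_carrier_of_knapp` with Knapp's presentation supplied by
`periodFunctional_ker_le_ellipticParabolic_sup_commutator_holds`).  The binders up to `hprim` are those of
`TwistedPeriodLatticeSaturation` for `N(W) = p²M`; BSD/K are not proved by this (the inputs `Ψ, hΨ, hm, hsoc, hM1` remain). -/
theorem saturation_at_of_carrier_of_multOne (hnf : exists_isNewformOf) (W : WeierstrassCurve ℚ) [W.IsElliptic] [W.IsGloballyMinimal]
    (hN : W.conductorNorm ℤ = p ^ 2 * M) (D : ModularParametrizationData W (p ^ 2 * M))
    (hp11 : 11 ≤ p) (hadd : Rank1Residual.Addv W p) (hirr : Rank1Residual.Irr W p)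
    (hGo : Summit.BirchSwinnertonDyer.Rank1Residual.Additive.TypeGOrd W p)
    (hV4 : padicValInt p W.minimalDiscriminantInt ≤ 4)
    (hopt : ∀ z ∈ D.L.lattice, ∃ w ∈ periodLattice D.f, z = D.c * w)
    (χ : DirichletCharacter ℂ p) (hχ : χ.IsQuadratic) (hprim : χ.IsPrimitive)
    {k : Type} [Field k] [CharP k p] [Algebra ℤ_[p] k] [Finite k]
    (hsurj : Surjective (algebraMap ℤ_[p] k))
    (halg : ∀ x : ℤ_[p], algebraMap ℤ_[p] k x = ZMod.castHom (dvd_refl p) k (PadicInt.toZMod x))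
    {b : ℕ} (hb : 0 < b) (hb2 : 2 * b < p - 1)
    (Ψ : spreadLattice ℤ_[p] p M hpM D.f →ₗ[ℤ_[p]] (Option (ZMod p) → ℤ_[p]))
    (hΨ : IsEquivariantOnSpread ℤ_[p] p M hpM D.f
      (coordRep (Kato2004.teichmullerChar p ^ (p - 1 - b)) (Kato2004.teichmullerChar p ^ b)) Ψ)
    {m : ℕ} (hm : ∀ v : Option (ZMod p) → ℤ_[p], (p : ℤ_[p]) ^ m • v ∈ LinearMap.range Ψ)
    (hsoc : ∀ Λ' : Subrepresentation (coordRep (Kato2004.teichmullerChar p ^ (p - 1 - b)) (Kato2004.teichmullerChar p ^ b)),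
      Λ'.toSubmodule = LinearMap.range Ψ →
        ReductionSocleLe p k (Kato2004.teichmullerChar p ^ (p - 1 - b)) (Kato2004.teichmullerChar p ^ b) (2 * b) Λ')
    (hM1 : MultOneHyp ℤ_[p] p M hpM D.f) :
    ∀ z ∈ periodLattice D.f, ∃ w ∈ periodLattice (charTwist (p ^ 2 * M) (dvd_refl _) (dvd_mul_right (p ^ 2) M) hχ D.f),
      z = gaussSum χ (ZMod.stdAddChar (N := p)) * w :=
  saturation_at_of_carrier_of_knapp p M hpM hnf W hN D hp11 hadd hirr hGo hV4 hopt χ hχ hprim hsurj halg hb hb2 Ψ hΨ hm hsoc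
    periodFunctional_ker_le_ellipticParabolic_sup_commutator_holds hM1

end Summit.BirchSwinnertonDyer.BirchSwinnertonDyer.Theorems.TeichmullerTwistDescent.CarrierMultOne
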